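import Literature.Analysis.FluidPDE.CollisionalTransfer
import Literature.Analysis.FluidPDE.HardSphereRegularGeometry
import Literature.MathematicalPhysics.KineticTheory.HardSphereEuler
import HarnessLib

/-!
# The co-moving localized pair virial along free flight (helper for stub `stub_activityDomination`)

Crux `Summit.AtomisticToContinuum.HydrodynamicLimit.Theses.OneFlightGossipEngine.CollisionActivityTails`
(stmt-AtomisticToContinuum-13734), line `SketchK1`, stub `stub_activityDomination : ActivityDomination`.
For a compactly supported `C¹` vector field `ζ : ℝ³ → ℝ³` (support in the ball of radius `2ε`, `2ε < 1/4`;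
the line uses the radial cutoff of `…CollisionActivityTailsCutoff`, but everything here is stated for an ARBITRARY
such field) and a tagged sphere `i`, the CO-MOVING LOCALIZED PAIR VIRIAL of a configuration `y` of `n` spheres on `𝕋³` is

`pairVirial ζ i y = Σ_j ⟪ζ(sep(x_j, x_i)), v_j − v_i⟫`, `sep = Torus.reprSym (x_j − x_i)` (minimal image),

and its streaming derivative is `pairVirialDeriv ζ i y = Σ_j ⟪D(ζ∘reprSym)(x_j − x_i)(v_j − v_i), v_j − v_i⟫`
(torus derivative `FunctionSpaces.Torus.fderiv`). This file proves:
* `isContDiff_comp_reprSym`: the periodization `q ↦ ζ (reprSym q)` is `C¹` on `𝕋³` (near a point whose minimal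
  image is short, `reprSym` is locally a translation — `Torus.reprSym_add_proj`; near the cut locus the field
  vanishes identically), and `torusFderiv_comp_reprSym`: its torus derivative is `Dζ ∘ reprSym`;
* `hasDerivAt_pairVirial_freeFlight`, `continuous_pairVirialDeriv_freeFlight`: along free flight
  `d/dt pairVirial = pairVirialDeriv` and the latter is continuous in time (the hypotheses of the tree's weak balance
  law `IsHardSphereTrajectory.sub_eq_integral_add_collisionalTransfer`);
* `abs_pairVirial_le`: `|pairVirial| ≤ 2ε Σ_{j ≠ i, dist ≤ 2ε} |v_j − v_i|` when `‖ζ‖ ≤ 2ε`;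
* `pairVirialDeriv_ge`: `pairVirialDeriv ≥ −2D Σ_{j ≠ i, dist ≤ 2ε} |v_j − v_i|²` when `⟪Dζ(y)h, h⟫ ≥ −2D‖h‖²`.
The registered helper statement is `PairVirialToolkit`.
-/

noncomputable section

open Set Filter Topology
open scoped InnerProductSpace

namespace Summit.AtomisticToContinuum.HydrodynamicLimit.Theorems.CollisionActivityTailsPairVirial

open Literature.Analysis.FluidPDE Literature.Analysis.FunctionSpaces
open Literature.MathematicalPhysics.KineticTheory (T3 V3)

/-! ## Minimal images away from the cut locus -/

/-- Each coordinate of a vector of `ℝ³` is bounded by its Euclidean norm. -/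
theorem abs_apply_le_norm (s : V3) (k : Fin 3) : |s k| ≤ ‖s‖ := by
  simpa using PiLp.norm_apply_le s k

/-- **Local linearity of the minimal image.** If `‖reprSym q‖ < 1/4` and `‖s‖ < 1/4` then
`reprSym (q + proj s) = reprSym q + s`. -/
theorem reprSym_add_proj_of_norm_lt {q : T3} {s : V3} (hq : ‖Torus.reprSym q‖ < 1 / 4) (hs : ‖s‖ < 1 / 4) :
    Torus.reprSym (q + Torus.proj s) = Torus.reprSym q + s := by
  refine Torus.reprSym_add_proj fun k => ?_
  have h1 := abs_le.1 ((Torus.abs_reprSym_apply_le_norm q k).trans hq.le)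
  have h2 := abs_le.1 ((abs_apply_le_norm s k).trans hs.le)
  have h1' := Torus.abs_reprSym_apply_le_norm q k
  have h2' := abs_apply_le_norm s k
  rw [abs_le] at h1' h2'
  constructor <;> linarith

/-- `proj` is additive: `proj (a - b) = proj a - proj b`. -/
theorem proj_sub' (a b : V3) : Torus.proj (a - b) = Torus.proj a - Torus.proj b := by
  rw [sub_eq_add_neg, Torus.proj_add, Torus.proj_neg, ← sub_eq_add_neg]

/-! ## Periodization of a compactly supported `C¹` field -/

section Periodization

variable {F : Type*} [NormedAddCommGroup F] [NormedSpace ℝ F]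

/-- **The periodization `q ↦ ζ (reprSym q)` of a `C¹` field supported in the ball of radius `2ε < 1/4` is `C¹` on
the torus.** -/
theorem isContDiff_comp_reprSym {ζ : V3 → F} {ε : ℝ} (hε : 2 * ε < 1 / 4) (hζ : ContDiff ℝ 1 ζ)
    (hζ0 : ∀ y, 2 * ε ≤ ‖y‖ → ζ y = 0) : Torus.IsContDiff 1 fun q : T3 => ζ (Torus.reprSym q) := by
  show ContDiff ℝ 1 (Torus.lift fun q : T3 => ζ (Torus.reprSym q))
  rw [contDiff_iff_contDiffAt]
  intro a
  by_cases hr : ‖Torus.reprSym (Torus.proj a)‖ < 1 / 4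
  · have hev : (Torus.lift fun q : T3 => ζ (Torus.reprSym q)) =ᶠ[𝓝 a]
        fun b => ζ (Torus.reprSym (Torus.proj a) + (b - a)) := by
      have hball : ∀ᶠ b in 𝓝 a, ‖b - a‖ < 1 / 4 := by
        have := Metric.ball_mem_nhds a (by norm_num : (0 : ℝ) < 1 / 4)
        filter_upwards [this] with b hb
        rwa [Metric.mem_ball, dist_eq_norm] at hb
      filter_upwards [hball] with b hb
      show ζ (Torus.reprSym (Torus.proj b)) = ζ (Torus.reprSym (Torus.proj a) + (b - a))
      have hb' : Torus.proj b = Torus.proj a + Torus.proj (b - a) := by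
        rw [← Torus.proj_add, add_sub_cancel]
      rw [hb', reprSym_add_proj_of_norm_lt hr hb]
    refine ContDiffAt.congr_of_eventuallyEq ?_ hev
    exact hζ.contDiffAt.comp a (contDiffAt_const.add (contDiffAt_id.sub contDiffAt_const))
  · have hlt : 2 * ε < ‖Torus.reprSym (Torus.proj a)‖ := by linarith [not_lt.1 hr]
    have hcont : Continuous fun b : V3 => ‖Torus.reprSym (Torus.proj b)‖ :=
      Torus.continuous_norm_reprSym.comp Torus.continuous_proj
    have hev : (Torus.lift fun q : T3 => ζ (Torus.reprSym q)) =ᶠ[𝓝 a] fun _ => (0 : F) := by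
      filter_upwards [(isOpen_lt continuous_const hcont).mem_nhds hlt] with b hb
      exact hζ0 _ (le_of_lt hb)
    exact contDiffAt_const.congr_of_eventuallyEq hev

/-- **The torus derivative of the periodization is `Dζ ∘ reprSym`.** -/
theorem torusFderiv_comp_reprSym {ζ : V3 → F} {ε : ℝ} (hε : 2 * ε < 1 / 4)
    (hζ0 : ∀ y, 2 * ε ≤ ‖y‖ → ζ y = 0) (q : T3) :
    Torus.fderiv (fun q : T3 => ζ (Torus.reprSym q)) q = fderiv ℝ ζ (Torus.reprSym q) := by
  unfold Torus.fderiv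
  by_cases hr : ‖Torus.reprSym q‖ < 1 / 4
  · have hev : Torus.liftAt (fun q : T3 => ζ (Torus.reprSym q)) q =ᶠ[𝓝 0]
        fun v => ζ (Torus.reprSym q + v) := by
      have hball : ∀ᶠ v in 𝓝 (0 : V3), ‖v‖ < 1 / 4 := by
        have := Metric.ball_mem_nhds (0 : V3) (by norm_num : (0 : ℝ) < 1 / 4)
        filter_upwards [this] with v hv
        rwa [Metric.mem_ball, dist_zero_right] at hv
      filter_upwards [hball] with v hv
      show ζ (Torus.reprSym (q + Torus.proj v)) = ζ (Torus.reprSym q + v)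
      rw [reprSym_add_proj_of_norm_lt hr hv]
    rw [hev.fderiv_eq, fderiv_comp_add_left, add_zero]
  · have hlt : 2 * ε < ‖Torus.reprSym q‖ := by linarith [not_lt.1 hr]
    have hcont : Continuous fun v : V3 => ‖Torus.reprSym (q + Torus.proj v)‖ :=
      Torus.continuous_norm_reprSym.comp (continuous_const.add Torus.continuous_proj)
    have h0 : 2 * ε < ‖Torus.reprSym (q + Torus.proj (0 : V3))‖ := by
      simpa [Torus.proj_zero] using hlt
    have hev : Torus.liftAt (fun q : T3 => ζ (Torus.reprSym q)) q =ᶠ[𝓝 0] fun _ => (0 : F) := by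
      filter_upwards [(isOpen_lt continuous_const hcont).mem_nhds h0] with v hv
      exact hζ0 _ (le_of_lt hv)
    have hev2 : ζ =ᶠ[𝓝 (Torus.reprSym q)] fun _ => (0 : F) := by
      filter_upwards [(isOpen_lt continuous_const continuous_norm).mem_nhds hlt] with y hy
      exact hζ0 y (le_of_lt hy)
    rw [hev.fderiv_eq, hev2.fderiv_eq, fderiv_const_apply, fderiv_const_apply]

end Periodization

/-! ## The observable and its streaming derivative -/

section Observable

variable {n : ℕ}

/-- The **co-moving localized pair virial** of the tagged sphere `i`:
`Σ_j ⟪ζ(sep(x_j, x_i)), v_j − v_i⟫`, `sep(x_j, x_i) = reprSym (x_j − x_i)` the minimal-image separation. -/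
def pairVirial (ζ : V3 → V3) (i : Fin n) (y : Config n (Fin 3) T3) : ℝ :=
  ∑ j, ⟪ζ (Torus.reprSym ((y j).1 - (y i).1)), (y j).2 - (y i).2⟫_ℝ

/-- The **streaming derivative** of the pair virial along free flight:
`Σ_j ⟪D(ζ ∘ reprSym)(x_j − x_i)(v_j − v_i), v_j − v_i⟫` (torus derivative). -/
def pairVirialDeriv (ζ : V3 → V3) (i : Fin n) (y : Config n (Fin 3) T3) : ℝ :=
  ∑ j, ⟪Torus.fderiv (fun q : T3 => ζ (Torus.reprSym q)) ((y j).1 - (y i).1) ((y j).2 - (y i).2),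
    (y j).2 - (y i).2⟫_ℝ

/-- Relative position along free flight on the torus: `x_j(t) − x_i(t) = (x_j − x_i) + proj (t (v_j − v_i))`. -/
theorem freeFlight_fst_sub (y : Config n (Fin 3) T3) (t : ℝ) (i j : Fin n) :
    (freeFlight (Torus.geometry (Fin 3)) t y j).1 - (freeFlight (Torus.geometry (Fin 3)) t y i).1 =
      ((y j).1 - (y i).1) + Torus.proj (t • ((y j).2 - (y i).2)) := by
  simp only [freeFlight_apply, Torus.geometry_translate, smul_sub, proj_sub']
  abel

/-- Velocities do not change along free flight. -/
theorem freeFlight_snd (y : Config n (Fin 3) T3) (t : ℝ) (j : Fin n) :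
    (freeFlight (Torus.geometry (Fin 3)) t y j).2 = (y j).2 := rfl

/-- **Streaming derivative of the pair virial**: along free flight `d/dt pairVirial = pairVirialDeriv`. -/
theorem hasDerivAt_pairVirial_freeFlight {ζ : V3 → V3} {ε : ℝ} (hε : 2 * ε < 1 / 4) (hζ : ContDiff ℝ 1 ζ)
    (hζ0 : ∀ y, 2 * ε ≤ ‖y‖ → ζ y = 0) (i : Fin n) (y : Config n (Fin 3) T3) (t : ℝ) :
    HasDerivAt (fun s => pairVirial ζ i (freeFlight (Torus.geometry (Fin 3)) s y))
      (pairVirialDeriv ζ i (freeFlight (Torus.geometry (Fin 3)) t y)) t := by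
  have hξ := isContDiff_comp_reprSym hε hζ hζ0
  unfold pairVirial pairVirialDeriv
  simp only [freeFlight_fst_sub, freeFlight_snd]
  refine HasDerivAt.fun_sum fun j _ => ?_
  have h1 := (Torus.hasDerivAt_apply_add_proj_smul hξ ((y j).1 - (y i).1) ((y j).2 - (y i).2) t).inner ℝ
    (hasDerivAt_const t ((y j).2 - (y i).2))
  simpa using h1

/-- The streaming derivative is continuous in time along every free flight. -/
theorem continuous_pairVirialDeriv_freeFlight {ζ : V3 → V3} {ε : ℝ} (hε : 2 * ε < 1 / 4)
    (hζ : ContDiff ℝ 1 ζ) (hζ0 : ∀ y, 2 * ε ≤ ‖y‖ → ζ y = 0) (i : Fin n) (y : Config n (Fin 3) T3) :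
    Continuous fun t : ℝ => pairVirialDeriv ζ i (freeFlight (Torus.geometry (Fin 3)) t y) := by
  have hξ := isContDiff_comp_reprSym hε hζ hζ0
  unfold pairVirialDeriv
  simp only [freeFlight_fst_sub, freeFlight_snd]
  refine continuous_finsetSum _ fun j _ => ?_
  have h1 : Continuous fun t : ℝ => Torus.fderiv (fun q : T3 => ζ (Torus.reprSym q))
      (((y j).1 - (y i).1) + Torus.proj (t • ((y j).2 - (y i).2))) :=
    (Torus.continuous_fderiv hξ).comp
      (continuous_const.add (Torus.continuous_proj.comp (continuous_id.smul continuous_const)))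
  exact (h1.clm_apply continuous_const).inner continuous_const

/-! ## Bounds -/

/-- The minimal-image distance of `x_j` from `x_i` is the norm of `reprSym (x_j − x_i)`. -/
theorem norm_reprSym_sub_eq (y : Config n (Fin 3) T3) (i j : Fin n) :
    ‖Torus.reprSym ((y j).1 - (y i).1)‖ = ‖(Torus.geometry (Fin 3)).sepVec (y j).1 (y i).1‖ := rfl

/-- **Endpoint bound**: `|pairVirial| ≤ 2ε Σ_{j ≠ i, dist(x_j,x_i) ≤ 2ε} |v_j − v_i|` for a field of norm `≤ 2ε`
vanishing beyond `2ε`. -/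
theorem abs_pairVirial_le {ζ : V3 → V3} {ε : ℝ} (hζb : ∀ y, ‖ζ y‖ ≤ 2 * ε)
    (hζ0 : ∀ y, 2 * ε ≤ ‖y‖ → ζ y = 0) (i : Fin n) (y : Config n (Fin 3) T3) :
    |pairVirial ζ i y| ≤ 2 * ε * ∑ j, (if j ≠ i ∧ ‖(Torus.geometry (Fin 3)).sepVec (y j).1 (y i).1‖ ≤ 2 * ε
      then ‖(y j).2 - (y i).2‖ else 0) := by
  unfold pairVirial
  rw [Finset.mul_sum]
  refine (Finset.abs_sum_le_sum_abs _ _).trans (Finset.sum_le_sum fun j _ => ?_)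
  split_ifs with h
  · calc |⟪ζ (Torus.reprSym ((y j).1 - (y i).1)), (y j).2 - (y i).2⟫_ℝ|
        ≤ ‖ζ (Torus.reprSym ((y j).1 - (y i).1))‖ * ‖(y j).2 - (y i).2‖ := abs_real_inner_le_norm _ _
      _ ≤ 2 * ε * ‖(y j).2 - (y i).2‖ := mul_le_mul_of_nonneg_right (hζb _) (norm_nonneg _)
  · rw [not_and_or, not_not, not_le] at h
    rcases h with h | h
    · subst h
      simp
    · rw [hζ0 _ (by rw [norm_reprSym_sub_eq]; exact h.le)]
      simp

/-- **Streaming bound**: `pairVirialDeriv ≥ −2D Σ_{j ≠ i, dist(x_j,x_i) ≤ 2ε} |v_j − v_i|²` for a field with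
`⟪Dζ(y)h, h⟫ ≥ −2D‖h‖²` vanishing beyond `2ε`. -/
theorem pairVirialDeriv_ge {ζ : V3 → V3} {ε D : ℝ} (hε : 2 * ε < 1 / 4)
    (hζ0 : ∀ y, 2 * ε ≤ ‖y‖ → ζ y = 0)
    (hζ2 : ∀ y h : V3, -(2 * D) * ‖h‖ ^ 2 ≤ ⟪fderiv ℝ ζ y h, h⟫_ℝ) (i : Fin n) (y : Config n (Fin 3) T3) :
    -(2 * D) * ∑ j, (if j ≠ i ∧ ‖(Torus.geometry (Fin 3)).sepVec (y j).1 (y i).1‖ ≤ 2 * ε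
      then ‖(y j).2 - (y i).2‖ ^ 2 else 0) ≤ pairVirialDeriv ζ i y := by
  unfold pairVirialDeriv
  rw [Finset.mul_sum]
  refine Finset.sum_le_sum fun j _ => ?_
  rw [torusFderiv_comp_reprSym hε hζ0]
  split_ifs with h
  · exact hζ2 _ _
  · rw [not_and_or, not_not, not_le] at h
    rcases h with h | h
    · subst h
      simp
    · have hlt : 2 * ε < ‖Torus.reprSym ((y j).1 - (y i).1)‖ := by rw [norm_reprSym_sub_eq]; exact h
      have hev : ζ =ᶠ[𝓝 (Torus.reprSym ((y j).1 - (y i).1))] fun _ => (0 : V3) := by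
        filter_upwards [(isOpen_lt continuous_const continuous_norm).mem_nhds hlt] with w hw
        exact hζ0 w (le_of_lt hw)
      rw [hev.fderiv_eq, fderiv_const_apply]
      simp

end Observable

/-! ## The registered helper statement -/

/-- **Pair-virial toolkit** (helper statement of stub `stub_activityDomination`, line SketchK1): for every `C¹` field
`ζ` on `ℝ³` supported in the ball of radius `2ε < 1/4`, every particle number `n` and tagged sphere `i`:
(1) along free flight on `𝕋³`, `t ↦ pairVirial ζ i (S_t y)` has derivative `pairVirialDeriv ζ i (S_t y)`, which is
continuous in `t`; (2) if `‖ζ‖ ≤ 2ε` then `|pairVirial ζ i y| ≤ 2ε Σ_{j ≠ i, dist ≤ 2ε} |v_j − v_i|`; (3) if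
`⟪Dζ(y)h,h⟫ ≥ −2D‖h‖²` (`D ≥ 0`) then `pairVirialDeriv ζ i y ≥ −2D Σ_{j ≠ i, dist ≤ 2ε} |v_j − v_i|²`. -/
def PairVirialToolkit : Prop :=
  ∀ (ζ : V3 → V3) (ε : ℝ), 0 ≤ ε → 2 * ε < 1 / 4 → ContDiff ℝ 1 ζ → (∀ y, 2 * ε ≤ ‖y‖ → ζ y = 0) →
    ∀ (n : ℕ) (i : Fin n),
    (∀ (y : Config n (Fin 3) T3) (t : ℝ),
      HasDerivAt (fun s => pairVirial ζ i (freeFlight (Torus.geometry (Fin 3)) s y))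
        (pairVirialDeriv ζ i (freeFlight (Torus.geometry (Fin 3)) t y)) t) ∧
    (∀ y : Config n (Fin 3) T3,
      Continuous fun t : ℝ => pairVirialDeriv ζ i (freeFlight (Torus.geometry (Fin 3)) t y)) ∧
    ((∀ y, ‖ζ y‖ ≤ 2 * ε) → ∀ y : Config n (Fin 3) T3,
      |pairVirial ζ i y| ≤ 2 * ε * ∑ j, (if j ≠ i ∧ ‖(Torus.geometry (Fin 3)).sepVec (y j).1 (y i).1‖ ≤ 2 * ε
        then ‖(y j).2 - (y i).2‖ else 0)) ∧
    (∀ D : ℝ, 0 ≤ D → (∀ y h : V3, -(2 * D) * ‖h‖ ^ 2 ≤ ⟪fderiv ℝ ζ y h, h⟫_ℝ) →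
      ∀ y : Config n (Fin 3) T3,
      -(2 * D) * ∑ j, (if j ≠ i ∧ ‖(Torus.geometry (Fin 3)).sepVec (y j).1 (y i).1‖ ≤ 2 * ε
        then ‖(y j).2 - (y i).2‖ ^ 2 else 0) ≤ pairVirialDeriv ζ i y)

/-- The pair-virial toolkit holds (registered helper `stub_pairVirialToolkit` of line SketchK1). -/
theorem stub_pairVirialToolkit : PairVirialToolkit :=
  fun _ζ _ε _hε0 hε hζ hζ0 _n i =>
    ⟨fun y t => hasDerivAt_pairVirial_freeFlight hε hζ hζ0 i y t,
      fun y => continuous_pairVirialDeriv_freeFlight hε hζ hζ0 i y,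
      fun hζb y => abs_pairVirial_le hζb hζ0 i y,
      fun _D _hD hζ2 y => pairVirialDeriv_ge hε hζ0 hζ2 i y⟩

end Summit.AtomisticToContinuum.HydrodynamicLimit.Theorems.CollisionActivityTailsPairVirial

end
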